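import Summits.BirchSwinnertonDyer.BirchSwinnertonDyer.Theorems.AlignedTransportAtTwoMainConjectureOfRankZeroBSDAtTwoTorsionPointFieldCrux
import HarnessLib

/-!
# Route `AlignedTransportAtTwo`, crux C2 `MainConjectureOfRankZeroBSDAtTwo` (stmt-BirchSwinnertonDyer-22298), line
# `birth`, road (b″) PER CURVE: Mazur's `2`-adic main conjecture for a rank-`0` seed from PRINT + its displayed Kato
# coinvariant data + Iwasawa's `μ₂ = 0` of ONE `2`-torsion point field — and the certificate-shaped seed clause C2♭

HONEST FRAMING (cell `bsd-f1-sign2`; WIDTH-5 attached prover seat `bsd-line-att-p5` gen 2; `--supports` 22298; closes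
nothing; BSD is proved for no curve here).  THEOREMS ONLY; CONDITIONAL on the displayed hypotheses.  Continuation
of `…TorsionPointField{,Doors,Crux}` (p597201 / p597544 / p597937).  The lead's road (b″) file
`…FineRoadCoinvCruxArch` has the per-DATUM kernel `selmerDual_mu_eq_zero_of_roadB2_arch_two` and the CLASS-WIDE
compositions (stub T, C2); what a planner's RESTATEMENT of C2 «with a certificate clause» (the menu C2′ = TowerGap
binder [att-p4 RESTATEMENT-KIT], C2‴ = ClassicalMu binder [lead 02:10Z]) needs on road (b″) is the PER-CURVE door
— supplied here with the class-group certificate in its point-field form: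

* `mazurMainConjecture_two_of_bsdp_of_fineRoadCoinvArch_pointFieldMu` — for ONE globally minimal `W`, good
  ordinary at `2`, no rational `2`-torsion, `r_an = 0`, `BSD(W,2)`, analytic `μ₂ = 0`: PRINT {Kato 17.4 (1)(2) at
  `2` for `W`, Greenberg 4.1, period unit, modularity, GZK, Lim 2017 Thm. 3.5 at `2`} + the displayed K₂‴ data
  FOR `W` (every cyclotomic datum; PRINT pending typing + the `×2` audit) + «`μ₂(ℚ(P)) = 0` for ONE non-zero
  `P ∈ W[2]`» (growth form; per curve two class numbers of the cubic tower `ℚ(P) ⊂ ℚ(P,√2) ⊂ …` via the Fukuda doors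
  of `…TorsionPointFieldDoors`) ⟹ `MazurMainConjecture W 2`.
* `mainConjectureOfRankZeroBSDAtTwo_certifiedFine` — the CLASS-WIDE statement with BOTH road-(b″) inputs moved
  into the seed clause as binders (C2♭: «a seed carries its Kato coinvariant data at `2` and a `2`-torsion point
  field with `μ₂ = 0`») is a THEOREM modulo PRINT — the road-(b″) twin of `AlignedTransportAtTwoSeed.mainConjectureOfRankZeroBSDAtTwo_certified`
  (TowerGap binder).  Offered to the planner-of-record as restatement text; nothing is registered here.

References: [Kato2004Asterisque] Thm. 17.4, Prop. 17.11, §17.13; [Lim2017FineSelmer] §3 Thm. 3.5; [CoatesSujatha2005] §3;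
[GreenbergLNM1716] Thm. 4.1, Conj. 1.11; [Fukuda1994] Thm. 1.
-/

noncomputable section

open scoped Classical

open Literature.NumberTheory.EllipticCurves Literature.NumberTheory.EllipticCurves.Module

namespace Summit.BirchSwinnertonDyer.BirchSwinnertonDyer.Theorems.AlignedTransportAtTwoTorsionPointField

open CongruenceSubgroup WeierstrassCurve Field Literature.NumberTheory.EllipticCurves.ModularForms
  Literature.NumberTheory.EllipticCurves.Greenberg1999
  Literature.NumberTheory.EllipticCurves.Rank1Residual
  Literature.NumberTheory.IwasawaTheory Literature.NumberTheory.GaloisRepresentations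
  Summit.BirchSwinnertonDyer.Rank1Residual Summit.BirchSwinnertonDyer.Rank1Residual.X1.MuLambda
  Summit.BirchSwinnertonDyer.Rank1Residual.X5 Summit.BirchSwinnertonDyer.Rank1Residual.F1Sign2
  Summit.BirchSwinnertonDyer.BirchSwinnertonDyer.Theorems.Rank1ResidualX1Defs
  Summit.BirchSwinnertonDyer.BirchSwinnertonDyer.Theses.AlignedTransportAtTwo
  Summit.BirchSwinnertonDyer.BirchSwinnertonDyer.Theorems.AlignedTransportAtTwoFineRoad

/-! ## §7 Road (b″) PER CURVE with the class-group certificate on `ℚ(P)` -/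

/-- **THE FINE ROAD (b″) PER CURVE, class-group input in point-field form.**  Let `W/ℚ` be globally minimal,
good ordinary at `2`, with no rational point of order `2`, `r_an = 0`, `BSD(W,2)` known and analytic `μ₂ = 0`
(`red G ≠ 0` for every even-branch lift).  Granted PRINT (Kato 17.4 (1)(2) at `2` for `W`, Greenberg 4.1, the
period unit, modularity, GZK, Lim 2017 Thm. 3.5 at `2`), the DISPLAYED Kato coinvariant data of `W` over
`ℚ(ζ_{2^∞})` for every cyclotomic datum (hypothesis `hK2W`: the lead's K₂‴ shape of `…FineRoadCoinvCruxArch`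
specialised to `W` — PRINT pending typing, not asserted), and Iwasawa's `μ = 0` in growth form for every
cyclotomic `ℤ₂`-extension of the torsion-point field `ℚ(P)` of ONE non-zero `P ∈ W[2]` (`hμ`): Mazur's `2`-adic
main conjecture for `W`.  Assembly: p583329's converse chain `mazurMainConjecture_two_of_bsdp_of_mu_eq_zero` ∘
per datum `selmerDual_mu_eq_zero_of_roadB2_arch_two` ∘ statement (A) at `(W,2)` from
`finite_fineSelmer_twoTorsion_of_classicalMu_pointField`.  CONDITIONAL.
[cite: Kato2004Asterisque, Thm. 17.4 (1)(2) (p. 273), Prop. 17.11 (p. 277), §17.13 (pp. 279–280)]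
[cite: Lim2017FineSelmer, §3 Thm. 3.5 and Lemma 3.2] [cite: GreenbergLNM1716, Thm. 4.1 (p. 102)] -/
theorem mazurMainConjecture_two_of_bsdp_of_fineRoadCoinvArch_pointFieldMu (W : WeierstrassCurve ℚ)
    [W.IsElliptic] [W.IsGloballyMinimal]
    (h17 : ∀ [NeZero (W.conductorNorm ℤ)] (f : CuspForm (Gamma0 (W.conductorNorm ℤ)) 2),
      kato_divisibility_allPrimes W 2 (f := f))
    (hGr : Greenberg1999.thm41_charValue_rankZero_anyPrime)
    (hper : realPeriodRat_eq_unit_mul_plusPeriod_two) (hmod : nonempty_modularParametrizationData)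
    (hGZK : rank_eq_analyticRank_of_analyticRank_le_one)
    (hLim : Lim2017.thm35_at_two_fineSelmerDual_moduleFinite_of_classicalMuVanishes_of_le_divisionField_four)
    (hord : IsOrdinaryAt W 2) (ht : ∀ x : ℚ, ¬ HasRationalTwoTorsionX W x) (hr : W.analyticRank = 0)
    (hbsd : BSDp W 2)
    (hμan : ∀ ⦃N : ℕ⦄ [NeZero N] (f : CuspForm (Gamma0 N) 2), IsNewformOf W f →
      ∀ G : IwasawaAlgebra 2, IsEvenBranchLiftAtTwo W f G → red G ≠ 0)
    (hK2W : ∀ (κ : ZpExtension ℚ 2) (γ : Field.absoluteGaloisGroup ℚ), κ.IsCyclotomic →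
      κ.IsTopGenerator γ → IsCyclotomicVariable 2 γ →
      ∀ ⦃N : ℕ⦄ [NeZero N] (f : CuspForm (Gamma0 N) 2), IsNewformOf W f →
      ∀ Gp : IwasawaAlgebra 2, iwasawaToPowerSeries 2 Gp = padicLFunction f (unitRoot W 2 : ℚ_[2]) →
      ∀ (D : W.SelmerDualData κ γ) (Yd : W.FineSelmerDualData κ γ),
        ∃ (P X' Y' : Type) (_ : AddCommGroup P) (_ : _root_.Module (IwasawaAlgebra 2) P)
          (_ : AddCommGroup X') (_ : _root_.Module (IwasawaAlgebra 2) X')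
          (_ : AddCommGroup Y') (_ : _root_.Module (IwasawaAlgebra 2) Y')
          (toX : P →ₗ[IwasawaAlgebra 2] X') (π : X' →ₗ[IwasawaAlgebra 2] Y')
          (cP : P →ₗ[IwasawaAlgebra 2] P) (cX : X' →ₗ[IwasawaAlgebra 2] X')
          (cY : Y' →ₗ[IwasawaAlgebra 2] Y')
          (col : P →ₗ[IwasawaAlgebra 2] IwasawaAlgebra 2 × IwasawaAlgebra 2) (w₁ w₂ : P)
          (a b s : IwasawaAlgebra 2) (fd : (X' ⧸ LinearMap.range (cX - 1)) →ₗ[IwasawaAlgebra 2] D.X)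
          (fy : (Y' ⧸ LinearMap.range (cY - 1)) →ₗ[IwasawaAlgebra 2] Yd.X),
          Function.Exact toX π ∧ Function.Surjective π ∧ toX ∘ₗ cP = cX ∘ₗ toX ∧ π ∘ₗ cX = cY ∘ₗ π ∧
          Function.Injective col ∧
          col ∘ₗ cP = (LinearEquiv.prodComm (IwasawaAlgebra 2) (IwasawaAlgebra 2) (IwasawaAlgebra 2) :
            IwasawaAlgebra 2 × IwasawaAlgebra 2 →ₗ[IwasawaAlgebra 2]
              IwasawaAlgebra 2 × IwasawaAlgebra 2) ∘ₗ col ∧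
          Finite ((IwasawaAlgebra 2 × IwasawaAlgebra 2) ⧸ LinearMap.range col) ∧
          toX w₁ = 0 ∧ toX w₂ = 0 ∧ col w₁ = (a, b) ∧ col w₂ = (b, a) ∧
          s ∉ IwasawaAlgebra.augIdealP 2 ∧ a + b = s * Gp ∧
          Module.Finite (IwasawaAlgebra 2) X' ∧ Module.IsTorsion (IwasawaAlgebra 2) X' ∧
          Finite (D.X ⧸ LinearMap.range fd) ∧
          lengthAt (IwasawaAlgebra 2) (LinearMap.ker fy)
              ⟨IwasawaAlgebra.augIdealP 2, IwasawaAlgebra.isPrime_augIdealP_holds 2⟩ ≤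
            lengthAt (IwasawaAlgebra 2) (LinearMap.ker fd)
              ⟨IwasawaAlgebra.augIdealP 2, IwasawaAlgebra.isPrime_augIdealP_holds 2⟩)
    {P : geomTorsion W 2} (hP : P ≠ 0)
    (hμ : ∀ κL : ZpExtension
        (IntermediateField.fixedField (MulAction.stabilizer (absoluteGaloisGroup ℚ) P)) 2,
      κL.IsCyclotomic → ClassicalMuVanishes κL) :
    MazurMainConjecture W 2 := by
  refine AlignedTransportAtTwoSeed.mazurMainConjecture_two_of_bsdp_of_mu_eq_zero W h17 hGr hper hmod
    hGZK hord ht hr hbsd fun κ γ hκ hγ hγ' D _ => ?_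
  have hirr : Irr W 2 := AlignedTransportAtTwoSeed.irr_two_of_forall_not_hasRationalTwoTorsionX W ht
  haveI : NeZero (W.conductorNorm ℤ) := ⟨(W.conductorNorm_pos_holds).ne'⟩
  obtain ⟨Dm⟩ := hmod W
  obtain ⟨Gp, hGp⟩ := exists_iwasawaToPowerSeries_eq_padicLFunction_two hord Dm.isNewformOf hirr
  have hred : red Gp ≠ 0 := hμan Dm.f Dm.isNewformOf Gp (Or.inl ⟨hord, hGp⟩)
  let Yd : W.FineSelmerDualData κ γ := W.fineSelmerDualData κ hγ
  obtain ⟨P', X', Y', _, _, _, _, _, _, toX, π, cP, cX, cY, col, w₁, w₂, a, b, s, fd, fy, hX, hπ, hcX, hcY,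
    hcol, hccol, hfin, h₁, h₂, hw₁, hw₂, hs, hab, hXfg, hXt, hfd, harch⟩ :=
    hK2W κ γ hκ hγ hγ' Dm.f Dm.isNewformOf Gp hGp D Yd
  have hA := finite_fineSelmer_twoTorsion_of_classicalMu_pointField hLim W hP hμ κ hκ
  exact selmerDual_mu_eq_zero_of_roadB2_arch_two W hγ D Yd hA hred toX π hX hπ cP cX cY hcX hcY col hcol
    hccol hfin h₁ h₂ hw₁ hw₂ hs hab hXfg hXt fd hfd fy harch

/-! ## §8 The certificate-shaped seed clause C2♭ of road (b″) is a theorem modulo PRINT -/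

/-- **C2♭ — `MainConjectureOfRankZeroBSDAtTwo` with the two road-(b″) inputs as PER-SEED CERTIFICATE BINDERS is a
THEOREM modulo PRINT.**  Granted PRINT {Kato 17.4 (1)(2) at `2` (all curves), Greenberg 4.1, period unit,
modularity, GZK, Lim 2017 Thm. 3.5 at `2`}: for every seed-cell curve `W` (non-CM, good ordinary at `2`, no
rational `2`-torsion, `Δ ∉ ℚ²`, `r_an = 0`, analytic `μ₂ = 0`, `BSD(W,2)`) that CARRIES (i) its Kato coinvariant
data at `2` (K₂‴ shape, every cyclotomic datum) and (ii) a non-zero `P ∈ W[2]` whose torsion-point field `ℚ(P)`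
has Iwasawa `μ₂ = 0` (growth form), Mazur's main conjecture holds at `2`.  This is the road-(b″) twin of the
certificate clause C2′ (`AlignedTransportAtTwoSeed.mainConjectureOfRankZeroBSDAtTwo_certified`, TowerGap binder):
restatement TEXT for the planner-of-record (per-seed binder (ii) is certified by two class numbers through the
Fukuda doors; binder (i) is typing).  Nothing is registered or asserted here; the crux item as filed stays open.
[cite: Kato2004Asterisque, Thm. 17.4 (1)(2) (p. 273) and §17.13 (pp. 279–280)] [cite: Lim2017FineSelmer, §3 Thm. 3.5 and Lemma 3.2]
[cite: GreenbergLNM1716, Thm. 4.1 (p. 102) and Conj. 1.11 (p. 58)] -/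
theorem mainConjectureOfRankZeroBSDAtTwo_certifiedFine
    (h17 : ∀ (V : WeierstrassCurve ℚ) [V.IsElliptic] [V.IsGloballyMinimal] [NeZero (V.conductorNorm ℤ)]
      (f : CuspForm (Gamma0 (V.conductorNorm ℤ)) 2), kato_divisibility_allPrimes V 2 (f := f))
    (hGr : Greenberg1999.thm41_charValue_rankZero_anyPrime)
    (hper : realPeriodRat_eq_unit_mul_plusPeriod_two) (hmod : nonempty_modularParametrizationData)
    (hGZK : rank_eq_analyticRank_of_analyticRank_le_one)
    (hLim : Lim2017.thm35_at_two_fineSelmerDual_moduleFinite_of_classicalMuVanishes_of_le_divisionField_four) :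
    ∀ (W : WeierstrassCurve ℚ) [W.IsElliptic] [W.IsGloballyMinimal], ¬ W.HasCM →
      IsOrdinaryAt W 2 → (∀ x : ℚ, ¬ HasRationalTwoTorsionX W x) → ¬ IsSquare W.Δ →
      W.analyticRank = 0 →
      (∀ ⦃N : ℕ⦄ [NeZero N] (f : CuspForm (Gamma0 N) 2), IsNewformOf W f →
        ∀ G : IwasawaAlgebra 2, IsEvenBranchLiftAtTwo W f G → red G ≠ 0) →
      BSDp W 2 →
      -- certificate binder (i): the displayed Kato coinvariant data of `W` at `2` (K₂‴ shape)
      (∀ (κ : ZpExtension ℚ 2) (γ : Field.absoluteGaloisGroup ℚ), κ.IsCyclotomic →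
        κ.IsTopGenerator γ → IsCyclotomicVariable 2 γ →
        ∀ ⦃N : ℕ⦄ [NeZero N] (f : CuspForm (Gamma0 N) 2), IsNewformOf W f →
        ∀ Gp : IwasawaAlgebra 2, iwasawaToPowerSeries 2 Gp = padicLFunction f (unitRoot W 2 : ℚ_[2]) →
        ∀ (D : W.SelmerDualData κ γ) (Yd : W.FineSelmerDualData κ γ),
          ∃ (P X' Y' : Type) (_ : AddCommGroup P) (_ : _root_.Module (IwasawaAlgebra 2) P)
            (_ : AddCommGroup X') (_ : _root_.Module (IwasawaAlgebra 2) X')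
            (_ : AddCommGroup Y') (_ : _root_.Module (IwasawaAlgebra 2) Y')
            (toX : P →ₗ[IwasawaAlgebra 2] X') (π : X' →ₗ[IwasawaAlgebra 2] Y')
            (cP : P →ₗ[IwasawaAlgebra 2] P) (cX : X' →ₗ[IwasawaAlgebra 2] X')
            (cY : Y' →ₗ[IwasawaAlgebra 2] Y')
            (col : P →ₗ[IwasawaAlgebra 2] IwasawaAlgebra 2 × IwasawaAlgebra 2) (w₁ w₂ : P)
            (a b s : IwasawaAlgebra 2) (fd : (X' ⧸ LinearMap.range (cX - 1)) →ₗ[IwasawaAlgebra 2] D.X)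
            (fy : (Y' ⧸ LinearMap.range (cY - 1)) →ₗ[IwasawaAlgebra 2] Yd.X),
            Function.Exact toX π ∧ Function.Surjective π ∧ toX ∘ₗ cP = cX ∘ₗ toX ∧ π ∘ₗ cX = cY ∘ₗ π ∧
            Function.Injective col ∧
            col ∘ₗ cP = (LinearEquiv.prodComm (IwasawaAlgebra 2) (IwasawaAlgebra 2) (IwasawaAlgebra 2) :
              IwasawaAlgebra 2 × IwasawaAlgebra 2 →ₗ[IwasawaAlgebra 2]
                IwasawaAlgebra 2 × IwasawaAlgebra 2) ∘ₗ col ∧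
            Finite ((IwasawaAlgebra 2 × IwasawaAlgebra 2) ⧸ LinearMap.range col) ∧
            toX w₁ = 0 ∧ toX w₂ = 0 ∧ col w₁ = (a, b) ∧ col w₂ = (b, a) ∧
            s ∉ IwasawaAlgebra.augIdealP 2 ∧ a + b = s * Gp ∧
            Module.Finite (IwasawaAlgebra 2) X' ∧ Module.IsTorsion (IwasawaAlgebra 2) X' ∧
            Finite (D.X ⧸ LinearMap.range fd) ∧
            lengthAt (IwasawaAlgebra 2) (LinearMap.ker fy)
                ⟨IwasawaAlgebra.augIdealP 2, IwasawaAlgebra.isPrime_augIdealP_holds 2⟩ ≤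
              lengthAt (IwasawaAlgebra 2) (LinearMap.ker fd)
                ⟨IwasawaAlgebra.augIdealP 2, IwasawaAlgebra.isPrime_augIdealP_holds 2⟩) →
      -- certificate binder (ii): a `2`-torsion point field with Iwasawa `μ₂ = 0`
      (∃ P : geomTorsion W 2, P ≠ 0 ∧
        ∀ κL : ZpExtension
            (IntermediateField.fixedField (MulAction.stabilizer (absoluteGaloisGroup ℚ) P)) 2,
          κL.IsCyclotomic → ClassicalMuVanishes κL) →
      MazurMainConjecture W 2 := by
  intro W _ _ _ hord ht _ hr hμan hbsd hK2W hPμ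
  obtain ⟨P, hP, hμ⟩ := hPμ
  haveI : NeZero (W.conductorNorm ℤ) := ⟨(W.conductorNorm_pos_holds).ne'⟩
  exact mazurMainConjecture_two_of_bsdp_of_fineRoadCoinvArch_pointFieldMu W (fun f => h17 W f) hGr hper
    hmod hGZK hLim hord ht hr hbsd hμan hK2W hP hμ

end Summit.BirchSwinnertonDyer.BirchSwinnertonDyer.Theorems.AlignedTransportAtTwoTorsionPointField

end
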